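import Mathlib
import HarnessLib
import HarnessLib.Audit
import Summits.ValiantsHypothesis.Statement
import Literature.Computability.AlgebraicComplexity.KabanetsImpagliazzoHardness
import Literature.Computability.AlgebraicComplexity.KRSTDesign
import Literature.Computability.AlgebraicComplexity.ValiantConjectureEquivProofs
import Literature.Barriers.ValiantsHypothesis.CT23SuccinctHittingSetsVersusVPSPACE
import Literature.Computability.AlgebraicComplexity.BLMW11WeakValiantHypothesis
import Literature.Computability.AlgebraicComplexity.FSV18SuccinctGenerators
import Literature.Computability.AlgebraicComplexity.CoeffDefinable
import Literature.Computability.Complexity.CountingHierarchy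
import Summits.ValiantsHypothesis.ValiantsHypothesis.Theorems.DefinabilityGapAffineRung
import Summits.ValiantsHypothesis.ValiantsHypothesis.Theorems.DefinabilityGapCHCut
import Summits.ValiantsHypothesis.ValiantsHypothesis.Theorems.DefinabilityGapGirth
import HarnessLib.Audit.Status.Attr

/-!
Route: DefinabilityGap

# Route DefinabilityGap — VH from a KI-planted permanent hitting generator plus a collapsed-world
definable annihilator

It suffices to show X = K1 ∧ K2c for ONE explicit polynomial map, the Kabanets–Impagliazzo generator
`G_m : ℂ^(q²) → ℂ^(q³)` planted with the permanent `per_m` on the quadratic-curve Nisan–Wigderson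
design
over `𝔽_q` (`q = q(m)` the least prime `≥ m² + 1`; coordinate `c ↦ per_m(y|S_c)`): K1
(`KIPlantedHitting`)
— for every exponent `b`, for infinitely many `m`, `G_m` hits every nonzero polynomial of circuit
size and
degree `≤ q^b`; K2c (`KIAnnihilatorDefinableOnCollapse`) — if `VP_ℂ = VNP_ℂ` then the vanishing
ideal of
`G_m` contains an eventually-nonzero `VNP_ℂ` family. Both parts are implied by VH (lossless split);
K1 is the
lower-bound content (declared residual, BARRIER), K2c is the definability gap this line attacks
(decomp-valiant
workshop cycle 1, lens 5 «hardness–randomness / PIT axis»; no idea card).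
Lean: `KIPlantedHitting ∧ KIAnnihilatorDefinableOnCollapse` where `KIPlantedHitting := ∀ b m₀ : ℕ, ∃
m, m₀ ≤ m ∧ ∀ D : MvPolynomial (Fin 3 → Fin (Literature.Computability.MetaComplexity.leastPrimeGe (m
* m + 1))) ℂ, D ≠ 0 → Literature.Computability.AlgebraicComplexity.complexity D ≤
Literature.Computability.MetaComplexity.leastPrimeGe (m * m + 1) ^ b → D.totalDegree ≤
Literature.Computability.MetaComplexity.leastPrimeGe (m * m + 1) ^ b → MvPolynomial.bind₁
(Literature.Computability.AlgebraicComplexity.kiGenerator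
(Literature.Computability.AlgebraicComplexity.perPad ℂ ((Nat.le_succ (m * m)).trans
(Literature.Computability.MetaComplexity.leastPrimeGe_spec (m * m + 1)).1)) (fun c : Fin 3 → Fin
(Literature.Computability.MetaComplexity.leastPrimeGe (m * m + 1)) => haveI : Fact (Nat.Prime
(Literature.Computability.MetaComplexity.leastPrimeGe (m * m + 1))) :=
⟨(Literature.Computability.MetaComplexity.leastPrimeGe_spec (m * m + 1)).2⟩; haveI : NeZero
(Literature.Computability.MetaComplexity.leastPrimeGe (m * m + 1)) :=
⟨(Literature.Computability.MetaComplexity.leastPrimeGe_spec (m * m + 1)).2.ne_zero⟩;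
(Literature.Computability.MetaComplexity.polyBlock (d := 2) (ZMod.finEquiv
(Literature.Computability.MetaComplexity.leastPrimeGe (m * m + 1))).toEquiv.toEmbedding (fun i =>
(ZMod.finEquiv (Literature.Computability.MetaComplexity.leastPrimeGe (m * m + 1))).toEquiv (c
i))).trans ((ZMod.finEquiv (Literature.Computability.MetaComplexity.leastPrimeGe (m * m +
1))).toEquiv.symm.prodCongr (ZMod.finEquiv (Literature.Computability.MetaComplexity.leastPrimeGe (m
* m + 1))).toEquiv.symm).toEmbedding)) D ≠ 0` and `KIAnnihilatorDefinableOnCollapse :=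
Literature.Computability.AlgebraicComplexity.VP ℂ = Literature.Computability.AlgebraicComplexity.VNP
ℂ → ∃ A : ∀ m : ℕ, MvPolynomial (Fin 3 → Fin (Literature.Computability.MetaComplexity.leastPrimeGe
(m * m + 1))) ℂ, Literature.Computability.AlgebraicComplexity.IsVNPFamily A ∧ ∃ m₁, ∀ m, m₁ ≤ m → A
m ≠ 0 ∧ MvPolynomial.bind₁ (Literature.Computability.AlgebraicComplexity.kiGenerator
(Literature.Computability.AlgebraicComplexity.perPad ℂ ((Nat.le_succ (m * m)).trans
(Literature.Computability.MetaComplexity.leastPrimeGe_spec (m * m + 1)).1)) (fun c : Fin 3 → Fin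
(Literature.Computability.MetaComplexity.leastPrimeGe (m * m + 1)) => haveI : Fact (Nat.Prime
(Literature.Computability.MetaComplexity.leastPrimeGe (m * m + 1))) :=
⟨(Literature.Computability.MetaComplexity.leastPrimeGe_spec (m * m + 1)).2⟩; haveI : NeZero
(Literature.Computability.MetaComplexity.leastPrimeGe (m * m + 1)) :=
⟨(Literature.Computability.MetaComplexity.leastPrimeGe_spec (m * m + 1)).2.ne_zero⟩;
(Literature.Computability.MetaComplexity.polyBlock (d := 2) (ZMod.finEquiv
(Literature.Computability.MetaComplexity.leastPrimeGe (m * m + 1))).toEquiv.toEmbedding (fun i =>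
(ZMod.finEquiv (Literature.Computability.MetaComplexity.leastPrimeGe (m * m + 1))).toEquiv (c
i))).trans ((ZMod.finEquiv (Literature.Computability.MetaComplexity.leastPrimeGe (m * m +
1))).toEquiv.symm.prodCongr (ZMod.finEquiv (Literature.Computability.MetaComplexity.leastPrimeGe (m
* m + 1))).toEquiv.symm).toEmbedding)) (A m) = 0`

## Assembly
Pure logic plus the tree's bundling bridges: assume `VP_ℂ = VNP_ℂ`; K2c yields a `VNP` annihilator
family `A`, which is
then in `VP` (`mem_VNP_ofFintype_iff_holds`, `mem_VP_ofFintype_iff_holds`), i.e. of size and degree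
`≤ m^c + c ≤ q(m)^b`
for `b = c + d + 1`; K1 at that `b` gives `m ≥ m₁` with `A_m ∘ G_m ≠ 0`, contradicting annihilation.
The deciding theorem
`closes : KIPlantedHitting → KIAnnihilatorDefinableOnCollapse → ValiantsHypothesis` is proved in
glue.lean (0 sorry).

Rationale: WHY THIS LINE. Mechanism: Kabanets–Impagliazzo hardness-to-randomness for algebraic circuits
(KabanetsImpagliazzo2003 Thm 27/Lemma 30;
KumarRamyaSaptharishiTengse2022 Lemma 8; tree-PROVED unconditional engine
`kiGenerator_isHittingSetGenerator`) turns
hardness of `per` into a hitting-set generator, and a hitting generator certifies hardness of its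
own ANNIHILATORS —
which are only known `VPSPACE⁰`-definable (ChatterjeeTengse2023 Thm 3.1, Lemma 4.7; tree
`CT23_thm_3_1_holds`), so the
PIT axis alone reaches the sub-summit `VPSPACE⁰_b ⊄ VP_ℂ`, not VH. The line isolates the missing
piece as ONE
definability statement read inside the collapsed world (K2c) and imports Boolean counting-complexity
to attack it:
under GRH `VP_ℂ = VNP_ℂ ⟹ PP ⊆ P/poly ⟹ CH ⊆ P/poly` (Burgisser2000 Cor. 4.6, Burgisser2006 Lemma
2.5; tree-PROVED
`PP_subset_PPoly_of_VP_eq_VNP`, `CH_subset_PPoly_of_PP_subset_PPoly_holds`) plus Koiran's form of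
Valiant's criterion, so
K2c follows from GRH and a counting-hierarchy upper bound for ONE eliminant of `G_m` (AnnCH), for
which the 2026 result
"Hilbert's Nullstellensatz is in the counting hierarchy" (arXiv:2602.17904, CH-uniform
constant-depth circuits for the
multivariate resultant) supplies the tool. No prior route plants the KI generator or uses
CH-definability of eliminants:
BarrierLever's hitting piece `SuccinctHittingSetsForVP` is NOT implied by VH and its
`DefinableEquations` quantifies over
all of VP; BoolTransfer/TauConst use CH-definability of explicit coefficient sequences, not of
annihilators; the retired
PlantedHittingSets route planted POINTS on `Z(per)` (VH-equivalent, not-a-thesis). Negatives index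
(32 entries): none
concerns generators, annihilators or VPSPACE.

RANKED CRUXES. #2 KIAnnihilatorDefinableOnCollapse (crux) — If `VP_ℂ = VNP_ℂ` then some `VNP_ℂ`
family `(A_m)`, `A_m ∈ ℂ[z_c : c ∈ 𝔽_q³]`, is eventually nonzero and annihilates the KI-planted
permanent map `G_m` (`A_m ∘ G_m = 0`). VH-implied (trivially); the attack is GRH ∧ AnnCH (a CH upper
bound for one eliminant of `G_m`) via the tree's Bürgisser transfer theorems. [difficulty: XL] (why
it might fail: every annihilator of G_m may need PSPACE-hard coefficient bits (succinct determinants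
are PSPACE-hard in general; the Macaulay resultant of this non-generic system vanishes identically,
and Canny-type perturbation may destroy the CH structure); GRH is load-bearing.) [Burgisser2000,
Burgisser2006, arXiv:2602.17904, ChatterjeeTengse2023, KumarRamyaSaptharishiTengse2022]
#3 KIPlantedHitting (crux) — For every `b`, for infinitely many `m`: every nonzero `q(m)³`-variate
polynomial `D` of circuit size and total degree `≤ q(m)^b` satisfies `D ∘ G_m ≠ 0` (the KI-planted
permanent map is an i.o. hitting-set generator against `VP`-size adversaries). VH-implied by the
tree's KI engine (certificate direction kernel-provable); declared RESIDUAL (the lower-bound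
content; leaf BARRIER). [difficulty: open-problem] (why it might fail: it fails only if VH fails (VH
implies it via kiGenerator_isHittingSetGenerator with q = Θ(m²)); as a stand-alone target it is an
explicit superpolynomial general-circuit lower bound (implies VPSPACE⁰_b ⊄ VP_ℂ by CT23 Thm 3.1).)
[KabanetsImpagliazzo2003, KumarRamyaSaptharishiTengse2022, ChatterjeeTengse2023]

TWO-LAYER PLAN. K2c ⇐ C1 → C2 → K2c with C1 := `VP_ℂ = VNP_ℂ → CH ⊆ P/poly` (GRH-conditional THEOREM
in the tree:
PP_subset_PPoly_of_VP_eq_VNP + CH_subset_PPoly_of_PP_subset_PPoly_holds; to be filed as `(hGRH :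
ExtendedRiemannHypothesis) →` form
or the route edited to a conditional bridge on GRH once C2 moves) and C2 := `CH ⊆ P/poly →
KIAnnihilatorDefinable` (content =
AnnCH: an eventually-nonzero annihilator family of G_m of p-bounded degree whose integer coefficient
bits are decidable in CH,
plus Koiran 2004 Thm 6.1 / Valiant's criterion in the tree pattern Burgisser2009_thm41_koiranStep).
AnnCH itself needs a typed
coefficient-bit language (encoding of (m, exponent vector, bit index)); filed informally after open.
K1 is not split (residual). The FRAME statements of the node file (asides, not items:
`KIAnnihilatorDefinable` = unconditional K2; `PspaceSeparation` = VPSPACE⁰_b ⊄ VP_ℂ;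
`CollapsePropagation` = PspaceSeparation → VH) are recorded in the workshop node
`run/shared/lean/pub/decomp-valiant/decomp-val-lens-5/DefinabilityGap.lean`, not filed.

KILL CRITERIA. Refuting K2c (a model-free proof that every annihilator family of G_m lies outside
VNP_ℂ whenever VP_ℂ = VNP_ℂ is consistent —
in practice: a PSPACE-hardness reduction for the coefficient bits of EVERY annihilator of G_m,
showing AnnCH false unless
PSPACE = CH) closes the route (`close --reason refuted:KIAnnihilatorDefinableOnCollapse`) and is
itself a recorded obstruction
for the whole PIT axis. K1 cannot be refuted without refuting VH. If BarrierLever's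
DefinableEquations (stmt-14611) is proved
in a form covering subvarieties of VNP-parametrised images, K2c is mooted (superseded).

NOT DECOMPOSED YET. The GRH step and the CH-typing of AnnCH (layer 2 above); the design/arith lemmas
(`IsNWDesign 2` of the quadratic-curve design
via isNWDesign_polyBlock, Bertrand `q(m) ≤ 2(m²+1)`), and the kernel certificate `ValiantsHypothesis
→ KIPlantedHitting`
(KI engine + complexity_perPad + totalDegree_perPad_le) — provable-now support a prover attaches
with `--supports`.

CHEAPEST FALSIFIER. Literature check of AnnCH's engine: does the CH-uniform multivariate-resultant
circuit family of arXiv:2602.17904 (Thm 1.1, §3–5)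
handle a system whose plain Macaulay resultant vanishes identically (here: the block permanents have
common zeros at infinity),
e.g. via Canny's generalised characteristic polynomial? A "no, and the perturbation needs sequential
rank computations" kills the
plan for K2c (not K2c itself). Run so far: the paper's §1.3 states general succinct linear systems
stay PSPACE and only the
resultant structure is exploited (read, p. 6); the instrument (m = 2) shows the first annihilators
ARE closed-form translates.

NUMBERS. q(m) = least prime ≥ m²+1 ≤ 2(m²+1) (Bertrand); design: q³ blocks of size q in a q²
universe, pairwise intersections ≤ 2;
KI threshold (tree constants): hitting against size/degree s needs L(per_m) > (s + q³(m+1)²(2m+2) +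
s·m + m + q² + 4)^7;
counting bound for the first annihilator degree t: C(q³+t, t) > C(q²+mt, mt): t = 3 (m=2, q=5), 21
(m=3, q=11), 79 (m=4, q=17);
instrument m=2: 125 coordinates, 50 monomials, rank 45, 80 linear annihilators (4-term second
differences); m=3: rank 1331/1331.

DEFINITION REQUESTS. AnnCH needs a coefficient-bit language for families indexed by (m, exponent
vector over 𝔽_q³, bit index) — to be typed on the
pattern of `encBitQuery`/`Burgisser2009_thm41_koiranStep`
(Literature/Computability/AlgebraicComplexity); request filed after open.

Novelty: Searches (2026-08-29): lit search --hybrid "Kabanets Impagliazzo generator permanent annihilator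
VNP" (generic hits: BCS1997,
AroraBarak2009, Landsberg2017); lit search "succinct hitting sets VPSPACE" →
[corpus:paper:arxiv-2309.07612] CT23;
lit search "equations for VP hard" → [corpus:paper:arxiv-2012.07056] KRST; lit search
"Nullstellensatz counting hierarchy" →
[corpus:paper:arxiv-2602.17904] (2026); lit galaxy search "Kabanets-Impagliazzo
generator|annihilating polynomial|succinct hitting set"
--star all (20 rows; relevant [galaxy:pdf:7080166046647163960] Kumar–Saraf
locally-low-algebraic-rank, [galaxy:pdf:2076602273240947740]
EGOW rank barriers); lit galaxy search "VPSPACE|counting hierarchy and arithmetic|generalized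
characteristic polynomial" --star pdf
(10 rows; relevant [galaxy:pdf:790914280] Dogan–Ergür–Tsigaridas complexity of Chow forms,
[galaxy:pdf:-6992943467848499040]
Mahajan–Rao small-space Valiant classes, [galaxy:pdf:3611799734385202520] Chatterjee–Gajjar–Tengse
monotone classes beyond VNP);
lean search kiGenerator / IsVPSPACE0bFamily / CH_subset_PPoly (tree decls cited above); ledger
negatives --problem ValiantsHypothesis (32, none related).
Nearest prior art found: KumarRamyaSaptharishiTengse2022 (arXiv:2012.07056) Thm 1 / Lemma 8 —
KI-gen(per) is a VNP-succinct hitting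
generator if per is exponentially hard; ChatterjeeTengse2023 (arXiv:2309.07612) Thm 1.3/3.1 —
succinct hitting sets give VPSPACE lower
bounds via FPSPACE annihilators; Dogan–Ergür–Tsigaridas  [refs: 2012.07056, 2309.07612, paper:arxiv-2309.07612, paper:arxiv-2012.07056, paper:arxiv-2602.17904, AroraBarak2009, Landsberg2017, KumarRamyaSaptharishiTengse2022, ChatterjeeTengse2023]

Barriers (technique_class: hardness-randomness, HSG, CH-definability, elimination): - technique_class: hardness-randomness, HSG, CH-definability, elimination
- Literature.Barriers.ValiantsHypothesis.AlgebraicNaturalProofs: outside — no VP-natural proof for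
VP is asserted; K2c's annihilator vanishes on the image of ONE VNP-parametrised map (a subvariety of
the VNP slice's coefficient vectors), not on VP_n, and K1 is a hitting statement for a VNP-planted
(not VP-succinct) generator, so FSV Thm 4 / SuccinctHittingSetsForVP does not quantify over either
piece; the catalogue files AlgebraicNaturalProofsPlanting
(`not_jointlySuccinct_of_plantsPermanentAt`: no VP-JOINT succinctness of a permanent-planted
generator — never claimed, the generator is VNP-succinct only, KRST §3.4) and
AlgebraicNaturalProofsKRSTVNP (per exp-hard ⟹ equations for the VNP slice are hard — the real-world
reading of K1; K2c lives in the collapsed world and asks VNP-, not VP-membership) are consistent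
with the line.
- Literature.Barriers.ValiantsHypothesis.AlgebraicNaturalProofsNarrow: outside for the same reason
(the narrowed class is distinguishers vanishing on ALL of SmallCircuits; Im(G_m) is a proper planted
family); the uncatalogued file CT23SuccinctHittingSetsVersusVPSPACE is the CEILING the line starts
from (K1 ⟹ VPSPACE⁰_b ⊄ VP_ℂ only); the bet is that CH-definability of one eliminant (AnnCH) plus
GRH lifts VPSPACE⁰ to VNP inside the collapsed world.
- Literature.Barriers.ValiantsHypothesis.FullRankMultilinear: rank-method barriers constrain a
future direct proof of K1 (declared resid

History (route lifecycle, newest last):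
- 2026-08-31T01:23:58Z · RESIDUAL declared: KIPlantedHitting (stmt-ValiantsHypothesis-23547) — summit-strength until shown otherwise: tribunal_fit.residual verbatim = [KIPlantedHitting, KIPlantedHittingWs, CollapseToVPws] (route payload, lens-5 lead): K1 (planner-decomp-val-writer-1-g5-0)

sub-problem: ValiantsHypothesis · status: draft · opened planner-decomp-val-lens-5-g0-0 2026-08-29T18:12:30Z · rev 10 · ledger route-ValiantsHypothesis-DefinabilityGap
GENERATED by the gate from the ledger (D-0016/17). Provers cite these decls: `theorem foo : Summit.ValiantsHypothesis.ValiantsHypothesis.Theses.DefinabilityGap.<Decl> := …` in Summits/ValiantsHypothesis/ValiantsHypothesis/Theorems/<Name>.lean.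
-/

namespace Summit.ValiantsHypothesis.ValiantsHypothesis.Theses.DefinabilityGap

open scoped BigOperators Topology Manifold Classical MeasureTheory ProbabilityTheory Matrix InnerProductSpace ComplexConjugate ContinuousMap
open Filter Set Function TopologicalSpace MeasureTheory

attribute [summit_statement] _root_.ValiantsHypothesis

open Literature.PNP

/-- item stmt-ValiantsHypothesis-23546 · crux · rank 2 · SPLIT (gen 1) into KIAnnihilatorCHDefinable, CollapseLiftsCH + glue Summit.ValiantsHypothesis.ValiantsHypothesis.Theorems.DefinabilityGapCHCut.k2c_of_chCut · direct attempts still welcome (low priority) · by planner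
why it might fail: every annihilator of G_m may need PSPACE-hard coefficient bits (succinct determinants are PSPACE-hard in general; the Macaulay resultant of this non-generic system vanishes identically, and Canny-type perturbation may destroy the CH structure); GRH is load-bearing.
sources: Burgisser2000, Burgisser2006, arXiv:2602.17904, ChatterjeeTengse2023, KumarRamyaSaptharishiTengse2022
[crux] If `VP_ℂ = VNP_ℂ` then some `VNP_ℂ` family `(A_m)`, `A_m ∈ ℂ[z_c : c ∈ 𝔽_q³]`, is eventually
nonzero and annihilates the KI-planted permanent map `G_m` (`A_m ∘ G_m = 0`). VH-implied
(trivially); the attack is GRH ∧ AnnCH (a CH upper bound for one eliminant of `G_m`) via the tree's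
Bürgisser transfer theorems. [difficulty: XL] -/
@[route_item "route-ValiantsHypothesis-DefinabilityGap", crux]
def KIAnnihilatorDefinableOnCollapse : Prop :=
  Literature.Computability.AlgebraicComplexity.VP ℂ = Literature.Computability.AlgebraicComplexity.VNP ℂ → ∃ A : ∀ m : ℕ, MvPolynomial (Fin 3 → Fin (Literature.Computability.MetaComplexity.leastPrimeGe (m * m + 1))) ℂ, Literature.Computability.AlgebraicComplexity.IsVNPFamily A ∧ ∃ m₁, ∀ m, m₁ ≤ m → A m ≠ 0 ∧ MvPolynomial.bind₁ (Literature.Computability.AlgebraicComplexity.kiGenerator (Literature.Computability.AlgebraicComplexity.perPad ℂ ((Nat.le_succ (m * m)).trans (Literature.Computability.MetaComplexity.leastPrimeGe_spec (m * m + 1)).1)) (fun c : Fin 3 → Fin (Literature.Computability.MetaComplexity.leastPrimeGe (m * m + 1)) => haveI : Fact (Nat.Prime (Literature.Computability.MetaComplexity.leastPrimeGe (m * m + 1))) := ⟨(Literature.Computability.MetaComplexity.leastPrimeGe_spec (m * m + 1)).2⟩; haveI : NeZero (Literature.Computability.MetaComplexity.leastPrimeGe (m * m + 1)) := ⟨(Literature.Computability.MetaComplexity.leastPrimeGe_spec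 (m * m + 1)).2.ne_zero⟩; (Literature.Computability.MetaComplexity.polyBlock (d := 2) (ZMod.finEquiv (Literature.Computability.MetaComplexity.leastPrimeGe (m * m + 1))).toEquiv.toEmbedding (fun i => (ZMod.finEquiv (Literature.Computability.MetaComplexity.leastPrimeGe (m * m + 1))).toEquiv (c i))).trans ((ZMod.finEquiv (Literature.Computability.MetaComplexity.leastPrimeGe (m * m + 1))).toEquiv.symm.prodCongr (ZMod.finEquiv (Literature.Computability.MetaComplexity.leastPrimeGe (m * m + 1))).toEquiv.symm).toEmbedding)) (A m) = 0

-- parent: KIAnnihilatorDefinableOnCollapse · child (gen 1)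
/--     item stmt-ValiantsHypothesis-23444 · crux · rank 201 · open
    parent: KIAnnihilatorDefinableOnCollapse · by planner
    why it might fail: succinct linear algebra is PSPACE-hard in general; nothing known forces THIS ideal to contain a CH/poly-describable member of p-bounded degree (Cramer/Siegel kernel vector = PSPACE/poly only, rung 4); by CT23 Prop 2.26-2.27 a refutation is itself a Boolean separation PSPACE/poly not<= CH/poly
    sources: arXiv:2309.07612, Burgisser2006, arXiv:0710.0360, arXiv:2406.06217, KoiranPerifel2007
[crux · child 1 of the CH cut of K2c] K2ch: the vanishing ideal of the KI-planted permanent map G_m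
= kiPer m contains an eventually-nonzero INTEGER p-family (p-bounded degree, poly bitsize) whose
Koiran–Perifel coefficient function (sign + bit languages, tree IsCoeffDefinableIn) is in CH/poly
(polyAdvice CH). UNDECIDED, not S-implied; sandwiched between the landed VPSPACE0_b rung
(k2c_vpspace0b_rung, p746302: PSPACE/poly coefficient bits) and the unconditional aside K2u; leaf
IDEA-NEEDED (structure-specific non-Cramer annihilator: character sums under the F_q^3 translation
symmetry; instrument: m=2 has 80 explicit 4-term linear annihilators, m=3 first forced relation in
degree 21) + INSTRUMENTABLE. PLACEMENT: Chatterjee–Tengse 2023 Thm 1.9/4.1 + Prop 2.26–2.27 (GRH)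
give HSG ⟹ VP≠VNP ∨ uniform NC¹⊄TC⁰ via CH = PSPACE; K2ch is the instance-level statement removing
that Boolean disjunct for the KI-planted permanent generator (k2ch_of_pspace_notch /
pspace_not_subset_CH_of_not_k2ch in v3/DefinabilityGapCH.lean). -/
@[route_item "route-ValiantsHypothesis-DefinabilityGap", crux]
def KIAnnihilatorCHDefinable : Prop :=
  ∃ A : ∀ m : ℕ, MvPolynomial (Fin 3 → Fin (Summit.ValiantsHypothesis.ValiantsHypothesis.Theorems.DefinabilityGapAffineRung.qOf m)) ℤ, Literature.Computability.AlgebraicComplexity.IsPFamily (σ := fun m => Fin 3 → Fin (Summit.ValiantsHypothesis.ValiantsHypothesis.Theorems.DefinabilityGapAffineRung.qOf m)) A ∧ Literature.Computability.AlgebraicComplexity.IsCoeffDefinableIn (Literature.Computability.Complexity.polyAdvice Literature.Computability.Complexity.CH) A ∧ ∃ m₁, ∀ m, m₁ ≤ m → A m ≠ 0 ∧ MvPolynomial.bind₁ (Summit.ValiantsHypothesis.ValiantsHypothesis.Theorems.DefinabilityGapAffineRung.kiPer m) (MvPolynomial.map (Int.castRingHom ℂ) (A m)) = 0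

-- parent: KIAnnihilatorDefinableOnCollapse · child (gen 1)
/--     item stmt-ValiantsHypothesis-23445 · support · rank 202 · open
    parent: KIAnnihilatorDefinableOnCollapse · by planner
    why it might fail: THEOREM-INPUT: true modulo GRH (Buergisser 2009/2024 Thm 4.10(2): VP=VNP over C + GRH => CH <= P/poly; then Valiant's criterion, B00 Prop 2.20 / KP11 Lemma 3); fails only if GRH fails AND Buergisser 2000 Cor 4.6 (the GRH-free Boolean half) fails; S-implied (vacuous under VP != VNP)
    sources: arXiv:2309.07612, arXiv:2406.06217, arXiv:0710.0360, Burgisser2000, Burgisser2000TCS, Burgisser2006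
[support · child 2 of the CH cut of K2c · THEOREM-INPUT mod GRH] LiftCH: if VP_C = VNP_C then every
integer p-family on the variables F_q^3 with CH/poly-definable coefficient function is (base-changed
to C) in VNP_C. Kernel modulo (i) the tree theorem PP_subset_PPoly_of_VP_eq_VNP C (ERH -> VP=VNP ->
PP <= P/poly; olean unbuilt on the farm, passed as the Prop PPOnCollapseGRH), (ii) ERH, (iii) the
library gap ValiantCriterionCoeff (Valiant's criterion in coefficient-language form: B00 Prop 2.20 /
survey Prop 2.27 + degree reduction Cor 4.7; tree has isVNPFamily_circuitSum,
isVNPFamily_gapCertCountGen, DefVNP.isVNPFamily_hPoly, IsVNPFamily.aeval) -- theorem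
collapseLiftsCH_of_GRH in the lens file v3/DefinabilityGapCH.lean; CH <= P/poly and CH/poly <=
P/poly steps are kernel (CH_subset_PPoly_of_PP_subset_PPoly_holds, polyAdvice_mono,
polyAdvice_PPoly_subset_PPoly). S-implied (collapseLiftsCH_of_vh). IN PRINT VERBATIM:
Chatterjee–Tengse 2023 Prop 2.27 proof sketch (arXiv:2309.07612 v1 Prop 33, p11): 'If VP = VNP, then
from [B09] CH collapses to P/poly [GRH]; by Valiant's criterion … any polynomial family whose
coefficient function belongs to CH must belong to VP'. -/
@[route_item "route-ValiantsHypothesis-DefinabilityGap", crux]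
def CollapseLiftsCH : Prop :=
  Literature.Computability.AlgebraicComplexity.VP ℂ = Literature.Computability.AlgebraicComplexity.VNP ℂ → ∀ A : ∀ m : ℕ, MvPolynomial (Fin 3 → Fin (Summit.ValiantsHypothesis.ValiantsHypothesis.Theorems.DefinabilityGapAffineRung.qOf m)) ℤ, Literature.Computability.AlgebraicComplexity.IsPFamily (σ := fun m => Fin 3 → Fin (Summit.ValiantsHypothesis.ValiantsHypothesis.Theorems.DefinabilityGapAffineRung.qOf m)) A → Literature.Computability.AlgebraicComplexity.IsCoeffDefinableIn (Literature.Computability.Complexity.polyAdvice Literature.Computability.Complexity.CH) A → Literature.Computability.AlgebraicComplexity.IsVNPFamily (σ := fun m => Fin 3 → Fin (Summit.ValiantsHypothesis.ValiantsHypothesis.Theorems.DefinabilityGapAffineRung.qOf m)) (fun m => MvPolynomial.map (Int.castRingHom ℂ) (A m))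

/-- glue for the split of `KIAnnihilatorDefinableOnCollapse`: landed theorem `Summit.ValiantsHypothesis.ValiantsHypothesis.Theorems.DefinabilityGapCHCut.k2c_of_chCut`. -/
theorem KIAnnihilatorDefinableOnCollapseGlueBy_holds : KIAnnihilatorCHDefinable → CollapseLiftsCH → KIAnnihilatorDefinableOnCollapse := _root_.Summit.ValiantsHypothesis.ValiantsHypothesis.Theorems.DefinabilityGapCHCut.k2c_of_chCut

/-- item stmt-ValiantsHypothesis-23547 · crux · RESIDUAL (gen 0; summit-strength until shown otherwise, D-0170) · rank 3 · SPLIT (gen 1) into KIPlantedHittingWs, CollapseToVPws + glue KIPlantedHittingOfWsSplit · direct attempts still welcome (low priority) · by planner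
why it might fail: it fails only if VH fails (VH implies it via kiGenerator_isHittingSetGenerator with q = Θ(m²)); as a stand-alone target it is an explicit superpolynomial general-circuit lower bound (implies VPSPACE⁰_b ⊄ VP_ℂ by CT23 Thm 3.1).
sources: KabanetsImpagliazzo2003, KumarRamyaSaptharishiTengse2022, ChatterjeeTengse2023
[crux] For every `b`, for infinitely many `m`: every nonzero `q(m)³`-variate polynomial `D` of
circuit size and total degree `≤ q(m)^b` satisfies `D ∘ G_m ≠ 0` (the KI-planted permanent map is an
i.o. hitting-set generator against `VP`-size adversaries). VH-implied by the tree's KI engine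
(certificate direction kernel-provable); declared RESIDUAL (the lower-bound content; leaf BARRIER).
[difficulty: open-problem] -/
@[route_item "route-ValiantsHypothesis-DefinabilityGap", crux (bottleneck := idea) (source := "ledger wanted_by.residual on stmt-ValiantsHypothesis-23547, 2026-09-01")]
def KIPlantedHitting : Prop :=
  ∀ b m₀ : ℕ, ∃ m, m₀ ≤ m ∧ ∀ D : MvPolynomial (Fin 3 → Fin (Literature.Computability.MetaComplexity.leastPrimeGe (m * m + 1))) ℂ, D ≠ 0 → Literature.Computability.AlgebraicComplexity.complexity D ≤ Literature.Computability.MetaComplexity.leastPrimeGe (m * m + 1) ^ b → D.totalDegree ≤ Literature.Computability.MetaComplexity.leastPrimeGe (m * m + 1) ^ b → MvPolynomial.bind₁ (Literature.Computability.AlgebraicComplexity.kiGenerator (Literature.Computability.AlgebraicComplexity.perPad ℂ ((Nat.le_succ (m * m)).trans (Literature.Computability.MetaComplexity.leastPrimeGe_spec (m * m + 1)).1)) (fun c : Fin 3 → Fin (Literature.Computability.MetaComplexity.leastPrimeGe (m * m + 1)) => haveI : Fact (Nat.Prime (Literature.Computability.MetaComplexity.leastPrimeGe (m * m + 1))) :=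 ⟨(Literature.Computability.MetaComplexity.leastPrimeGe_spec (m * m + 1)).2⟩; haveI : NeZero (Literature.Computability.MetaComplexity.leastPrimeGe (m * m + 1)) := ⟨(Literature.Computability.MetaComplexity.leastPrimeGe_spec (m * m + 1)).2.ne_zero⟩; (Literature.Computability.MetaComplexity.polyBlock (d := 2) (ZMod.finEquiv (Literature.Computability.MetaComplexity.leastPrimeGe (m * m + 1))).toEquiv.toEmbedding (fun i => (ZMod.finEquiv (Literature.Computability.MetaComplexity.leastPrimeGe (m * m + 1))).toEquiv (c i))).trans ((ZMod.finEquiv (Literature.Computability.MetaComplexity.leastPrimeGe (m * m + 1))).toEquiv.symm.prodCongr (ZMod.finEquiv (Literature.Computability.MetaComplexity.leastPrimeGe (m * m + 1))).toEquiv.symm).toEmbedding)) D ≠ 0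

-- parent: KIPlantedHitting · child (gen 1)
/--     item stmt-ValiantsHypothesis-23701 · crux · rank 301 · open
    parent: KIPlantedHitting · by planner
    why it might fail: Fails only if VP = VNP (S ⟹ K1 ⟹ K1ws, kernel). As a stand-alone target it is an explicit superpolynomial ABP / determinantal-complexity lower bound for a VPSPACE⁰-explicit family; frontier is Ω(n²) (Chatterjee–Kumar–She–Volk 2022), dc(per_m) ≥ (m−1)²+1 (Mignon–Ressayre).
    sources: KabanetsImpagliazzo2003, BurgisserEtAl2011, doi:10.4230/LIPIcs.CCC.2020.33, ChatterjeeTengse2023, KumarRamyaSaptharishiTengse2022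
[crux] K1ws (child 1 of the glued split of KIPlantedHitting; dial position VP_ws = VBP): for every
b, for infinitely many m, every nonzero q(m)^3-variate polynomial D of WEAKLY-SKEW circuit size (=
ABP size up to poly) L_ws(D) ≤ q(m)^b satisfies D ∘ G_m ≠ 0 — the KI-planted permanent generator is
an i.o. hitting-set generator against VP_ws-size adversaries (no degree binder: deg ≤ L_ws + 1).
S-implied (S → K1 → K1ws, kernel: complexity_le_wsComplexity, totalDegree_le_wsComplexity_succ);
with K2c it already yields Valiant's WEAK hypothesis DcPerSuperpolynomial (kernel glue_census in the
lens file); unconditional kernel rung: every D with 4·L_ws(D) < m² is hit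
(kiPlantedHittingWs_rung_size). Leaf BARRIER one notch below K1: an explicit superpolynomial ABP
lower bound. -/
@[route_item "route-ValiantsHypothesis-DefinabilityGap"]
def KIPlantedHittingWs : Prop :=
  ∀ b m₀ : ℕ, ∃ m, m₀ ≤ m ∧ ∀ D : MvPolynomial (Fin 3 → Fin (Literature.Computability.MetaComplexity.leastPrimeGe (m * m + 1))) ℂ, D ≠ 0 → Literature.Computability.AlgebraicComplexity.wsComplexity D ≤ Literature.Computability.MetaComplexity.leastPrimeGe (m * m + 1) ^ b → MvPolynomial.bind₁ (Literature.Computability.AlgebraicComplexity.kiGenerator (Literature.Computability.AlgebraicComplexity.perPad ℂ ((Nat.le_succ (m * m)).trans (Literature.Computability.MetaComplexity.leastPrimeGe_spec (m * m + 1)).1)) (fun c : Fin 3 → Fin (Literature.Computability.MetaComplexity.leastPrimeGe (m * m + 1)) => haveI : Fact (Nat.Prime (Literature.Computability.MetaComplexity.leastPrimeGe (m * m + 1))) := ⟨(Literature.Computability.MetaComplexity.leastPrimeGe_spec (m * m + 1)).2⟩; haveI : NeZero (Literature.Computability.MetaComplexity.leastPrimeGe (m * m + 1)) := ⟨(Literature.Computability.MetaComplexity.leastPrimeGe_spec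 (m * m + 1)).2.ne_zero⟩; (Literature.Computability.MetaComplexity.polyBlock (d := 2) (ZMod.finEquiv (Literature.Computability.MetaComplexity.leastPrimeGe (m * m + 1))).toEquiv.toEmbedding (fun i => (ZMod.finEquiv (Literature.Computability.MetaComplexity.leastPrimeGe (m * m + 1))).toEquiv (c i))).trans ((ZMod.finEquiv (Literature.Computability.MetaComplexity.leastPrimeGe (m * m + 1))).toEquiv.symm.prodCongr (ZMod.finEquiv (Literature.Computability.MetaComplexity.leastPrimeGe (m * m + 1))).toEquiv.symm).toEmbedding)) D ≠ 0

-- parent: KIPlantedHitting · child (gen 1)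
/--     item stmt-ValiantsHypothesis-23702 · crux · rank 302 · open
    parent: KIPlantedHitting · by planner
    why it might fail: False exactly in a world with VP_ws ⊊ VP = VNP: nothing known forces a VP = VNP collapse to propagate from polynomial-size circuits to polynomial-size ABPs (only quasi-polynomial, VSBR83); no technique re-balances the permanent's hypothetical small circuits.
    sources: BurgisserEtAl2011, ValiantEtAl1983, MalodPortier2008, Burgisser2000
[crux] Bws (child 2 of the glued split of KIPlantedHitting; collapse propagation one notch down the
dial): if VP_ℂ = VNP_ℂ then every VNP family has p-bounded weakly-skew complexity (VNP ⊆ VP_ws =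
VBP). S-implied (vacuously); EXACTLY the census bridge B_VBP: Bws ⟺ (DcPerSuperpolynomial ℂ → S)
(kernel bws_iff_residual); also implied by the collapse VP ⊆ VP_ws (kernel bws_of_vp_subset_vpws),
so it is true in both extreme worlds and refutable only in a world with VP_ws ⊊ VP = VNP. The
quasi-polynomial version is a theorem (VSBR83: VP ⊆ quasi-poly ABPs). Declared RESIDUAL-shaped (no
plan: poly vs quasi-poly re-balancing, leaf IDEA-NEEDED). -/
@[route_item "route-ValiantsHypothesis-DefinabilityGap"]
def CollapseToVPws : Prop :=
  Literature.Computability.AlgebraicComplexity.VP ℂ = Literature.Computability.AlgebraicComplexity.VNP ℂ → ∀ (v : ℕ → ℕ) (f : ∀ n, MvPolynomial (Fin (v n)) ℂ), Literature.Computability.AlgebraicComplexity.IsVNPFamily f → Literature.Computability.AlgebraicComplexity.IsVPwsFamily f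

-- parent: KIPlantedHitting · glue (gen 1)
/--     item stmt-ValiantsHypothesis-23703 · support · rank 303 · closed · proved by Summit.ValiantsHypothesis.ValiantsHypothesis.Theorems.DefinabilityGapWsSplit.kiPlantedHittingOfWsSplit_holds (planner)
    parent: KIPlantedHitting · GLUE: children ⟹ parent · by planner
KIPlantedHittingWs → CollapseToVPws → KIPlantedHitting: by cases on VP = VNP — if VP ≠ VNP the KI
engine gives K1 outright; if VP = VNP the failing annihilators form a VP ⊆ VNP family,
CollapseToVPws puts it in VP_ws and KIPlantedHittingWs hits it (kernel proof ready:
decomp-val-lens-5/split/SplitGlue.lean, theorem SplitGlue.kiPlantedHitting_of_split, 0 sorry) -/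
@[route_item "route-ValiantsHypothesis-DefinabilityGap"]
def KIPlantedHittingOfWsSplit : Prop :=
  KIPlantedHittingWs → CollapseToVPws → KIPlantedHitting

-- `KIPlantedHittingOfWsSplit` holds: proved by `Summit.ValiantsHypothesis.ValiantsHypothesis.Theorems.DefinabilityGapWsSplit.kiPlantedHittingOfWsSplit_holds` (its module imports this route file, so no `_holds` link can be stated here).

/-- item stmt-ValiantsHypothesis-23704 · aside · rank 9 · open · by planner
[aside · rung of KIPlantedHittingWs, kind aside] K1ro: for every b, for infinitely many m, the
KI-planted permanent map G_m hits every nonzero q(m)^3-variate polynomial computed by a READ-ONCE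
OBLIVIOUS ABP in ANY variable order π, of width, individual degree and total degree ≤ q(m)^b.
S-implied (kernel k1ro_of_k1 / k1ro_of_vh in decomp-val-lens-5/DefinabilityGapWs.lean: such an ROABP
is a circuit of size ≤ q^(4b+6)); in print K1ws → K1ro. NOT a barrier leaf: explicit exponential
ROABP lower bounds (Nisan 1991, per/det in every order) and ROABP PIT technology (coefficient-span
dimension, rank concentration FS13, basis isolation AGKS15) exist; OPEN because Kabanets–Impagliazzo
reconstruction leaves the ROABP model (composition with ≤2-variate block substitutions is not
read-once). First proved instance: the affine rung (Theorems/DefinabilityGapAffineRung.lean,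
p740435): for m ≥ 3 no nonzero total-degree-≤1 polynomial annihilates G_m; sharp at m = 2 (80 linear
annihilators). Sources: ForbesShpilkaVolk2018 §5.3; Nisan1991; AgrawalGurjarKorwarSaxena2015;
KabanetsImpagliazzo2003 L.30. KERNEL ARROWS: S → K1 → K1ro (lens k1ro_of_k1) and K1ws → K1ro (lens
k1ro_of_k1ws via Theorems/Definabi -/
@[route_item "route-ValiantsHypothesis-DefinabilityGap"]
def KIPlantedHittingRO : Prop :=
  ∀ b m₀ : ℕ, ∃ m, m₀ ≤ m ∧ ∀ (π : Fin (Literature.Computability.MetaComplexity.leastPrimeGe (m * m + 1) ^ 3) ≃ (Fin 3 → Fin (Literature.Computability.MetaComplexity.leastPrimeGe (m * m + 1)))) (D : MvPolynomial (Fin 3 → Fin (Literature.Computability.MetaComplexity.leastPrimeGe (m * m + 1))) ℂ), D ≠ 0 → Literature.Computability.AlgebraicComplexity.IsROABP ℂ (Literature.Computability.MetaComplexity.leastPrimeGe (m * m + 1) ^ b) (Literature.Computability.MetaComplexity.leastPrimeGe (m * m + 1) ^ b) π D → D.totalDegree ≤ Literature.Computability.MetaComplexity.leastPrimeGe (m *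 m + 1) ^ b → MvPolynomial.bind₁ (Literature.Computability.AlgebraicComplexity.kiGenerator (Literature.Computability.AlgebraicComplexity.perPad ℂ ((Nat.le_succ (m * m)).trans (Literature.Computability.MetaComplexity.leastPrimeGe_spec (m * m + 1)).1)) (fun c : Fin 3 → Fin (Literature.Computability.MetaComplexity.leastPrimeGe (m * m + 1)) => haveI : Fact (Nat.Prime (Literature.Computability.MetaComplexity.leastPrimeGe (m * m + 1))) := ⟨(Literature.Computability.MetaComplexity.leastPrimeGe_spec (m * m + 1)).2⟩; haveI : NeZero (Literature.Computability.MetaComplexity.leastPrimeGe (m * m + 1)) := ⟨(Literature.Computability.MetaComplexity.leastPrimeGe_spec (m * m + 1)).2.ne_zero⟩; (Literature.Computability.MetaComplexity.polyBlock (d := 2) (ZMod.finEquiv (Literature.Computability.MetaComplexity.leastPrimeGe (m * m + 1))).toEquiv.toEmbedding (fun i => (ZMod.finEquiv (Literature.Computability.MetaComplexity.leastPrimeGe (m * m + 1))).toEquiv (c i))).trans ((ZMod.finEquiv (Literature.Computability.MetaComplexity.leastPrimeGe (m * m + 1))).toEquiv.symm.prodCongr (ZMod.finEquiv (Literature.Computability.MetaComplexity.leastPrimeGe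 (m * m + 1))).toEquiv.symm).toEmbedding)) D ≠ 0

/-- item stmt-ValiantsHypothesis-23705 · aside · rank 9 · closed · proved by Summit.ValiantsHypothesis.ValiantsHypothesis.Theorems.DefinabilityGapVQPwsAside.collapseToVQPws_holds (planner) · by planner
[aside · proved rung of the wall Bws = CollapseToVPws] VP = VNP ⟹ VNP ⊆ VQP_ws: under the collapse
every p-definable family has quasi-polynomially bounded weakly-skew (= ABP) complexity. PROVED in
the tree: Theorems/DefinabilityGapVQPwsRung.lean (p741996 ACCEPTED, lens decomp-val-lens-5 g2)
`isQPBounded_wsComplexity_of_isVNPFamily_of_collapse (hEq : VP ℂ = VNP ℂ) (hf : IsVNPFamily f) :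
IsQPBounded fun n => wsComplexity (f n)` (via VP ⊆ VQP_ws,
`isQPBounded_wsComplexity_of_isVPFamily`); a prover closes this item by `exact fun hEq v f hf =>
Summit.ValiantsHypothesis.ValiantsHypothesis.Theorems.DefinabilityGapVQPwsRung.isQPBounded_wsComplexity_of_isVNPFamily_of_collapse
hEq hf`. It is the quasi-polynomial rung one notch below the child crux CollapseToVPws (poly bound);
never staffed (kind aside, bc6). Sources: BurgisserEtAl2011 (BLMW11 §6 formulas vs weakly-skew),
ValiantEtAl1983 (VSBR depth reduction ⇒ VP ⊆ VQP_e ⊆ VQP_ws), Burgisser2000. -/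
@[route_item "route-ValiantsHypothesis-DefinabilityGap"]
def CollapseToVQPws : Prop :=
  Literature.Computability.AlgebraicComplexity.VP ℂ = Literature.Computability.AlgebraicComplexity.VNP ℂ → ∀ (v : ℕ → ℕ) (f : ∀ n, MvPolynomial (Fin (v n)) ℂ), Literature.Computability.AlgebraicComplexity.IsVNPFamily f → Literature.Computability.AlgebraicComplexity.IsQPBounded fun n => Literature.Computability.AlgebraicComplexity.wsComplexity (f n)

-- `CollapseToVQPws` holds: proved by `Summit.ValiantsHypothesis.ValiantsHypothesis.Theorems.DefinabilityGapVQPwsAside.collapseToVQPws_holds` (its module imports this route file, so no `_holds` link can be stated here).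

/-- item stmt-ValiantsHypothesis-23737 · aside · rank 9 · open · by planner
[aside · ROAD under K2c, critic CLEARED 21:05:02Z in road form only; never in closes] K2u
(STRENGTHENING of the attacked crux K2c = KIAnnihilatorDefinableOnCollapse, dropping the collapse
hypothesis): the KI-planted permanent map G_m : ℂ^{q²} → ℂ^{q³} (q = q(m) the least prime ≥ m²+1;
coordinate c ↦ per_m(y|S_c) on the quadratic-curve design) has, for all large m, a nonzero
annihilator A_m with (A_m) a VNP family (p-bounded degree, p-definable). Unconditional and NOT
S-implied: together with the residual K1 (KIPlantedHitting) it gives S by the route's closes (K2u →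
K2c is `fun h _ => h`, sketch k2c_of_k2u), and under S it says something new (hitting ⟹ hardness
would run through an EXPLICIT annihilator: the classical HSG ⇒ lower-bound paradigm,
Heintz–Schnorr/Agrawal, with the annihilator in VNP). Proved rung:
Theorems/DefinabilityGapK2cPFamilyRung.k2c_pFamily_rung (the same family shape with IsVNPFamily
truncated to IsPFamily, via CT23 Lemma 3.2). BC7 probe: CLEAN (P1 portfolio fails, P5 C→S fails).
Why it might fail: The only annihilators in print are kernel vectors of an exp-dimensional linear
system (Cramer ⇒ coefficient functions in PSPACE/poly = VPSPACE⁰_b, CT23 Thm 3.1/Lemma -/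
@[route_item "route-ValiantsHypothesis-DefinabilityGap"]
def KIAnnihilatorDefinable : Prop :=
  ∃ A : ∀ m : ℕ, MvPolynomial (Fin 3 → Fin (Literature.Computability.MetaComplexity.leastPrimeGe (m * m + 1))) ℂ, Literature.Computability.AlgebraicComplexity.IsVNPFamily A ∧ ∃ m₁, ∀ m, m₁ ≤ m → A m ≠ 0 ∧ MvPolynomial.bind₁ (Literature.Computability.AlgebraicComplexity.kiGenerator (Literature.Computability.AlgebraicComplexity.perPad ℂ ((Nat.le_succ (m * m)).trans (Literature.Computability.MetaComplexity.leastPrimeGe_spec (m * m + 1)).1)) (fun c : Fin 3 → Fin (Literature.Computability.MetaComplexity.leastPrimeGe (m * m + 1)) => haveI : Fact (Nat.Prime (Literature.Computability.MetaComplexity.leastPrimeGe (m * m + 1))) := ⟨(Literature.Computability.MetaComplexity.leastPrimeGe_spec (m * m + 1)).2⟩; haveI : NeZero (Literature.Computability.MetaComplexity.leastPrimeGe (m * m + 1)) := ⟨(Literature.Computability.MetaComplexity.leastPrimeGe_spec (m * m + 1)).2.ne_zero⟩; (Literature.Computability.MetaComplexity.polyBlock (d := 2) (ZMod.finEquiv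 (Literature.Computability.MetaComplexity.leastPrimeGe (m * m + 1))).toEquiv.toEmbedding (fun i => (ZMod.finEquiv (Literature.Computability.MetaComplexity.leastPrimeGe (m * m + 1))).toEquiv (c i))).trans ((ZMod.finEquiv (Literature.Computability.MetaComplexity.leastPrimeGe (m * m + 1))).toEquiv.symm.prodCongr (ZMod.finEquiv (Literature.Computability.MetaComplexity.leastPrimeGe (m * m + 1))).toEquiv.symm).toEmbedding)) (A m) = 0

/-- item stmt-ValiantsHypothesis-23738 · aside · rank 9 · closed · proved by Summit.ValiantsHypothesis.ValiantsHypothesis.Theorems.DefinabilityGapK2pspAside.kiAnnihilatorInVPSPACE_holds (planner) · by planner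
[aside · RUNG under K2c, theorem-grade; critic 21:05:02Z: bank as aside, NOT a split child] K2psp
(the VPSPACE_b rung of K2c on the definability ladder): the planted KI permanent map G_m has, for
all large m, a nonzero annihilator family in VPSPACE_b over ℂ (tree predicate
Literature.Barriers.ValiantsHypothesis.IsVPSPACEbFamily: p-bounded degree, constant-free projection
circuits of p-bounded size with p-bounded workspace, finitely many field constants). Route to a
proof: the tree's NAMED FACT CT23_thm_3_1 (annihilators of ENCODED maps by projection circuits of
size (m·d·s)^c) applied to an encoding U(y,w) of G_m by a poly(q)-size projection circuit — per_m is
computed by poly-size circuits WITH summation gates (VNP ⊆ VPSPACE⁰: tree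
isVPSPACE0Family_of_isVNP0Family) and the curve selection y_(i,c(i)) = Σ_j δ_j(w_i)·y_(i,j) is
Lagrange interpolation in the constants; the encoding lemma is the first prover target. Rung landed:
k2c_pFamily_rung (p-family, no definability). BC7 probe CLEAN. Why it might fail: Only modulo the
unproved tree fact CT23_thm_3_1 (its VPSPACE construction is not in the tree) and an encoding lemma
whose constants-vs-constant-free bookkeeping (IsVPSPACEFamily a -/
@[route_item "route-ValiantsHypothesis-DefinabilityGap"]
def KIAnnihilatorInVPSPACE : Prop :=
  ∃ A : ∀ m : ℕ, MvPolynomial (Fin 3 → Fin (Literature.Computability.MetaComplexity.leastPrimeGe (m * m + 1))) ℂ, Literature.Barriers.ValiantsHypothesis.IsVPSPACEbFamily ℂ A ∧ ∃ m₁, ∀ m, m₁ ≤ m → A m ≠ 0 ∧ MvPolynomial.bind₁ (Literature.Computability.AlgebraicComplexity.kiGenerator (Literature.Computability.AlgebraicComplexity.perPad ℂ ((Nat.le_succ (m * m)).trans (Literature.Computability.MetaComplexity.leastPrimeGe_spec (m * m + 1)).1)) (fun c : Fin 3 → Fin (Literature.Computability.MetaComplexity.leastPrimeGe (m * m + 1))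 => haveI : Fact (Nat.Prime (Literature.Computability.MetaComplexity.leastPrimeGe (m * m + 1))) := ⟨(Literature.Computability.MetaComplexity.leastPrimeGe_spec (m * m + 1)).2⟩; haveI : NeZero (Literature.Computability.MetaComplexity.leastPrimeGe (m * m + 1)) := ⟨(Literature.Computability.MetaComplexity.leastPrimeGe_spec (m * m + 1)).2.ne_zero⟩; (Literature.Computability.MetaComplexity.polyBlock (d := 2) (ZMod.finEquiv (Literature.Computability.MetaComplexity.leastPrimeGe (m * m + 1))).toEquiv.toEmbedding (fun i => (ZMod.finEquiv (Literature.Computability.MetaComplexity.leastPrimeGe (m * m + 1))).toEquiv (c i))).trans ((ZMod.finEquiv (Literature.Computability.MetaComplexity.leastPrimeGe (m * m + 1))).toEquiv.symm.prodCongr (ZMod.finEquiv (Literature.Computability.MetaComplexity.leastPrimeGe (m * m + 1))).toEquiv.symm).toEmbedding)) (A m) = 0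

-- `KIAnnihilatorInVPSPACE` holds: proved by `Summit.ValiantsHypothesis.ValiantsHypothesis.Theorems.DefinabilityGapK2pspAside.kiAnnihilatorInVPSPACE_holds` (its module imports this route file, so no `_holds` link can be stated here).

/-- item stmt-ValiantsHypothesis-30413 · support · rank 9 · closed · proved by Summit.ValiantsHypothesis.ValiantsHypothesis.Theorems.DefinabilityGapGirth.kiPlantedHitting_one (planner) · by planner
[support] (aside — banked partial result toward the residual crux KIPlantedHitting, not in the cone
of `closes`) the exponent-ONE clause of KIPlantedHitting (R_K1.1): for infinitely many m every
nonzero D with complexity D ≤ q and deg D ≤ q has D ∘ G_m ≠ 0. PROVED (0 sorry) by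
Summit.ValiantsHypothesis.ValiantsHypothesis.Theorems.DefinabilityGapGirth.kiPlantedHitting_one
(p765555; girth of the planted KI design > 2q+1 via one-column pivot certificates, 45 Theorems files
DefinabilityGap*). Why it might fail: it does not — proved; sources: lens-5 NODE-v7 §J,
KabanetsImpagliazzo04. -/
@[route_item "route-ValiantsHypothesis-DefinabilityGap"]
def KIPlantedHittingOne : Prop :=
  ∀ m₀ : ℕ, ∃ m, m₀ ≤ m ∧ ∀ D : MvPolynomial (Fin 3 → Fin (Summit.ValiantsHypothesis.ValiantsHypothesis.Theorems.DefinabilityGapAffineRung.qOf m)) ℂ, D ≠ 0 → Literature.Computability.AlgebraicComplexity.complexity D ≤ Summit.ValiantsHypothesis.ValiantsHypothesis.Theorems.DefinabilityGapAffineRung.qOf m ^ 1 → D.totalDegree ≤ Summit.ValiantsHypothesis.ValiantsHypothesis.Theorems.DefinabilityGapAffineRung.qOf m ^ 1 → MvPolynomial.bind₁ (Summit.ValiantsHypothesis.ValiantsHypothesis.Theorems.DefinabilityGapAffineRung.kiPer m) D ≠ 0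

/-- `KIPlantedHittingOne` holds: proved by `Summit.ValiantsHypothesis.ValiantsHypothesis.Theorems.DefinabilityGapGirth.kiPlantedHitting_one`. -/
theorem KIPlantedHittingOne_holds : KIPlantedHittingOne := _root_.Summit.ValiantsHypothesis.ValiantsHypothesis.Theorems.DefinabilityGapGirth.kiPlantedHitting_one

/-- item stmt-ValiantsHypothesis-23548 · assembly · rank 1 · closed · proved by Summit.ValiantsHypothesis.ValiantsHypothesis.Theorems.DefinabilityGapAssembly.assembly_holds (planner) · by planner
sources: KabanetsImpagliazzo2003
[assembly] KIPlantedHitting → KIAnnihilatorDefinableOnCollapse → ValiantsHypothesis -/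
@[route_item "route-ValiantsHypothesis-DefinabilityGap"]
def Assembly : Prop :=
  KIPlantedHitting → KIAnnihilatorDefinableOnCollapse → _root_.ValiantsHypothesis

-- `Assembly` holds: proved by `Summit.ValiantsHypothesis.ValiantsHypothesis.Theorems.DefinabilityGapAssembly.assembly_holds` (its module imports this route file, so no `_holds` link can be stated here).

/-! D-0027 §2.1 — DECIDING THEOREM (planner-authored via `route open/edit --closes-file`; by planner-decomp-val-lens-5-g0-0 2026-08-29T18:12:30Z):
its hypotheses are this route's items and its conclusion the sub-problem Statement (glue_lint), and it elaborates with this file. -/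

@[closes "route-ValiantsHypothesis-DefinabilityGap"] theorem closes (h₁ : KIPlantedHitting) (h₂ : KIAnnihilatorDefinableOnCollapse) :
    _root_.ValiantsHypothesis := by
  show Literature.Computability.AlgebraicComplexity.VP ℂ ≠ Literature.Computability.AlgebraicComplexity.VNP ℂ
  intro hEq
  obtain ⟨Q, hQ, m₁, hann⟩ := h₂ hEq
  have hVNP : Literature.Computability.AlgebraicComplexity.PolyFamily.ofFintype Q ∈ Literature.Computability.AlgebraicComplexity.VNP ℂ :=
    (Literature.Computability.AlgebraicComplexity.mem_VNP_ofFintype_iff_holds Q).2 hQ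
  rw [← hEq] at hVNP
  obtain ⟨⟨-, ⟨d, hd⟩⟩, ⟨c, hc⟩⟩ := (Literature.Computability.AlgebraicComplexity.mem_VP_ofFintype_iff_holds Q).1 hVNP
  obtain ⟨m, hm, hhit⟩ := h₁ (c + d + 1) m₁
  obtain ⟨hQ0, hQann⟩ := hann m hm
  -- arithmetic: m^c + c ≤ q^(c+d+1) with q = leastPrimeGe (m*m+1) ≥ max 2 m
  have hq2 : 2 ≤ Literature.Computability.MetaComplexity.leastPrimeGe (m * m + 1) :=
    (Literature.Computability.MetaComplexity.leastPrimeGe_spec (m * m + 1)).2.two_le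
  have hmq : m ≤ Literature.Computability.MetaComplexity.leastPrimeGe (m * m + 1) :=
    (Nat.le_mul_self m).trans ((Nat.le_succ _).trans (Literature.Computability.MetaComplexity.leastPrimeGe_spec (m * m + 1)).1)
  have key : ∀ c e : ℕ, m ^ c + c ≤ Literature.Computability.MetaComplexity.leastPrimeGe (m * m + 1) ^ (c + e + 1) := by
    intro c e
    have h1 : m ^ c ≤ Literature.Computability.MetaComplexity.leastPrimeGe (m * m + 1) ^ c := Nat.pow_le_pow_left hmq c
    have h2 : c ≤ 2 ^ c := (Nat.lt_two_pow_self).le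
    have h3 : 2 ^ c ≤ Literature.Computability.MetaComplexity.leastPrimeGe (m * m + 1) ^ c := Nat.pow_le_pow_left hq2 c
    have h4 : Literature.Computability.MetaComplexity.leastPrimeGe (m * m + 1) ^ c * 2 ≤ Literature.Computability.MetaComplexity.leastPrimeGe (m * m + 1) ^ (c + e + 1) := by
      calc Literature.Computability.MetaComplexity.leastPrimeGe (m * m + 1) ^ c * 2
          ≤ Literature.Computability.MetaComplexity.leastPrimeGe (m * m + 1) ^ c * Literature.Computability.MetaComplexity.leastPrimeGe (m * m + 1) := Nat.mul_le_mul_left _ hq2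
        _ = Literature.Computability.MetaComplexity.leastPrimeGe (m * m + 1) ^ (c + 1) := (pow_succ _ c).symm
        _ ≤ Literature.Computability.MetaComplexity.leastPrimeGe (m * m + 1) ^ (c + e + 1) := Nat.pow_le_pow_right (by omega) (by omega)
    omega
  refine hhit (Q m) hQ0 ?_ ?_ hQann
  · exact (hc m).trans (key c d)
  · rw [show c + d + 1 = d + c + 1 by omega]
    exact (hd m).trans (key d c)

end Summit.ValiantsHypothesis.ValiantsHypothesis.Theses.DefinabilityGap
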